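/-
Copyright (c) 2026 the pub-hodgecm-mathlib formalisation cell (harness21).  Prover seat hodgecm-mathlib-R90-IF-p01 (g0), programme R90-TF, section S9 «InnerForm-13.3.6 (c)»,
sequel to ★ `Theorems/R90S9SimilCongrAutQuotient.lean` (p861490): the (B3a) → (B3b) JUNCTION beneath `R90.S9.sock_S9_similitudeTransport`.
-/
import Summits.HodgeConjecture.HodgeConjecture.Theorems.R90S9SimilCongrAutQuotient   -- ★ p861490 (B3a): `exists_similCongr_discreteAutomorphicRep`, `equivariant_symm`, `formCongr_smul_to_simil`
import Literature.NumberTheory.Automorphic.UnitaryGroupCohomologicalForms            -- ★ `DiscreteAutomorphicRep.finRep`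
import Literature.NumberTheory.Automorphic.UnitaryGroupPlaceInclusion                -- ★ `inclPlace`, `evalAt_inclPlace_of_over`, `eq_of_forall_evalPlace_eq`
import Literature.NumberTheory.Automorphic.UnitaryGroupLocalCongr                    -- ★ `toLocalGL`, `localGLPiEquiv_toLocalGL_apply`, `evalAt_toFinAdeleGL`
import Literature.NumberTheory.Automorphic.AdelicCongruenceLocalCompat               -- ★ `formCongr_toLocalGL_one_smul` (the similitude read over `L ⊗ L⁺_v`)
import Literature.NumberTheory.Automorphic.SmoothRepresentation                      -- ★ `Representation.smoothPart`, `IsSmoothVector`, `stabilizerSubgroup`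
import HarnessLib

/-!
# R90-TF · S9 — the (B3a) → (B3b) junction: the rational similitude `x ↦ B x B⁻¹ : U(H)(𝔸) ≃ U(H₀)(𝔸)` carries a discrete `P` to `P₀` WITH, at every finite place `v`,
# an EQUIVALENCE of the smooth local representations `P₀|_{U(H₀)_v} ≅ P|_{U(H)_v} ∘ Ad(B_v)⁻¹` (Rogawski 1990 §14.2; Platonov–Rapinchuk 1994 §2.3, §5.1; Borel–Jacquet 1979 §4.1)

Cell `hodgecm-mathlib`, crux H413 = `stmt-HodgeConjecture-24833` (supports-only, count-neutral), route of record `HCCMUnconditional`; programme R90-TF (brief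
`director/R90-BRIEF.v2.md` 1f40d54518340a35), section S9 = InnerForm-13.3.6 (c), seat R90-IF-p01 (g0).  THEOREMS ONLY (no `def`, no `instance`, no named-fact hypothesis, no
`sorry`).  ★ p861490 (this seat) carries a discrete automorphic `P` of `U(H)` to `P₀ = U(P)` of `U(H₀)` with a `Φ`-EQUIVARIANT `e : P ≃ P₀` along the adelic similitude `Φ`,
`Φ x = B_𝔸 x B_𝔸⁻¹`; ★ p861492 (R90-IF-p02, (B3b) `R90.S9.comap_isConstituentOf_iff_of_localEquiv` ∕ `memXiFamily_of_localCongr`) makes local constituents and `MemXiFamily`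
ride once, AT EVERY FINITE `v`, a `Representation.Equiv` between the smooth local representation of `P₀` and that of `P` pulled back along
`ψ_v = localPiEquiv_{H₀} ≫ e_v⁻¹ ≫ localPiEquiv_H⁻¹` is given (its binder `φ v`).  THIS FILE PRODUCES THAT `φ v` from p861490's output, for ANY identification
`e_v : U(H)(L⁺_v) ≃ₜ* U(H₀)(L⁺_v)` with the value law `e_v g = B_v g B_v⁻¹` (e.g. ★ `cmDatumLocalCongr L v (toLocalGL L v B) _ _`, value law `rfl`).  Everything is stated in
the VALUE-LAW style of ★ `AdelicSimilitudeCongr` and typed on `adelicGroupData L⁺ L c N H` (= `cmDatum L N H`, ★ `adelicGroupData_eq_cmDatum`, `rfl`) as (B0) `XiMembershipAt` is.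

## Contents (all proved)
* §1 value laws of `Φ` on the finite-adelic group: `similCongr_symm_val` (`Φ⁻¹ x = B_𝔸⁻¹ x B_𝔸`), `archPart_similCongr_finAdelicToAdelic` (`(Φ (1, z))_∞ = 1`),
  `coe_finPart_similCongr_finAdelicToAdelic` (`(Φ (1, z))_f = B_f z B_f⁻¹`), `similCongr_finAdelicToAdelic_eq` (`Φ (1, z) = (1, (Φ (1, z))_f)`).
* §2 `similCongr_inclPlaceAdelic` — at a finite `v`: `Φ (ι_v y) = ι_v⁰ (localPiEquiv_{H₀}⁻¹ (e_v (localPiEquiv_H y)))` for the place inclusions `ι_v = finAdelicToAdelic ∘ inclPlace v`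
  (coordinates: ★ `evalAt_inclPlace_of_over ∕ _of_not_over`, ★ `evalAt_toFinAdeleGL`, ★ `localGLPiEquiv_toLocalGL_apply`).
* §3 smooth vectors correspond under a `Φ`-equivariant `e : P ≃ P₀`: `mem_stabilizer_finRep_iff_of_equivariant`, `isSmoothVector_finRep_iff_of_equivariant`.
* §4 **`exists_localEquiv_of_equivariant`** — the `Representation.Equiv` `φ v` of p861492's binder, `= e⁻¹` on vectors; §5 **`exists_similCongr_localEquiv`** — assembled (★ generic
  §1–§5 of p861490 on the `adelicGroupData` carriers) from (B3)'s own binders `formCongr (cmConjRingHom L) B (a • H₀) = H`, `a ≠ 0`: `Φ, Ψ, Ψ_* μ` automorphic, `P₀`, `e` AND `φ v`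
  for every value-law `e_v`; `formCongr_toLocalGL_smul` — the local data `(B_v, c_v)` of ★ `cmDatumLocalCongr` ∕ ★ `memXiFamily_of_localCongr`.
HONEST LABEL: plumbing; proves no printed statement about automorphic forms; HC_CM is proved only modulo the 7 printed citations (2 remaining named inputs: hLiu418 =
`stmt-HodgeConjecture-24832`, h413 = `stmt-HodgeConjecture-24833`) until rung 0 closes.

## References
* [Rogawski1990] J. D. Rogawski, *Automorphic Representations of Unitary Groups in Three Variables*, Ann. of Math. Stud. 123 (1990), §14.2 pp. 232–234 («`G′_v` is isomorphic to
  `G_v` if `v` is finite … the equivalence classes of representations of `G_v` and `G′_v` are canonically identified»), §1.9 p. 8.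
* [PlatonovRapinchuk1994] V. Platonov, A. Rapinchuk, *Algebraic Groups and Number Theory* (1994), §2.3, §5.1.
* [BorelJacquet1979] A. Borel, H. Jacquet, *Automorphic forms and automorphic representations*, PSPM 33.1 (1979), §4.1, §4.6.
-/

set_option autoImplicit false
set_option linter.dupNamespace false  -- the mandated namespace repeats the summit's segment (`HodgeConjecture.HodgeConjecture`)

noncomputable section

open NumberField IsDedekindDomain MeasureTheory Topology
open scoped Matrix MatrixGroups
open Literature.NumberTheory.Automorphic Literature.NumberTheory.Automorphic.UnitaryGroup

namespace Summit.HodgeConjecture.HodgeConjecture.R90.S9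

/-! ## §1 Value laws of `Φ` on the finite-adelic group `U(H)(𝔸_f) = {(1, z)}` -/

section FinAdelic

variable {L : Type} [Field L] [NumberField L] [IsCMField L] {N : ℕ} {H₀ H : Matrix (Fin N) (Fin N) L} (B : GL (Fin N) L)
  (Φ : (adelicGroupData (↥(maximalRealSubfield L)) L (IsCMField.complexConj L) N H).Adelic ≃ₜ*
    (adelicGroupData (↥(maximalRealSubfield L)) L (IsCMField.complexConj L) N H₀).Adelic)
  (hΦ : ∀ x : (adelicGroupData (↥(maximalRealSubfield L)) L (IsCMField.complexConj L) N H).Adelic,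
    (Subtype.val (Φ x) : GL (Fin N) (AdeleRing (𝓞 L) L)) = toAdeleGL L B * (Subtype.val x : GL (Fin N) (AdeleRing (𝓞 L) L)) * (toAdeleGL L B)⁻¹)

include hΦ

/-- **`Φ⁻¹ x = B_𝔸⁻¹ x B_𝔸`**, in the value-law shape for `B⁻¹`. [cite: PlatonovRapinchuk1994, §2.3] -/
theorem similCongr_symm_val (x : (adelicGroupData (↥(maximalRealSubfield L)) L (IsCMField.complexConj L) N H₀).Adelic) :
    (Subtype.val (Φ.symm x) : GL (Fin N) (AdeleRing (𝓞 L) L)) = toAdeleGL L B⁻¹ * (Subtype.val x : GL (Fin N) (AdeleRing (𝓞 L) L)) * (toAdeleGL L B⁻¹)⁻¹ := by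
  have h := hΦ (Φ.symm x)
  rw [ContinuousMulEquiv.apply_symm_apply] at h
  rw [map_inv, inv_inv, h]
  group

/-- **`(Φ (1, z))_∞ = 1`**: the archimedean component of the image of a finite-adelic point is trivial (`(B_𝔸)_∞ · 1 · (B_𝔸)_∞⁻¹ = 1`). [cite: BorelJacquet1979, §4.1] -/
theorem archPart_similCongr_finAdelicToAdelic (z : finAdelic (↥(maximalRealSubfield L)) L (IsCMField.complexConj L) N H) :
    archPart (↥(maximalRealSubfield L)) L (IsCMField.complexConj L) N H₀ (Φ (finAdelicToAdelic (↥(maximalRealSubfield L)) L (IsCMField.complexConj L) N H z)) = 1 := by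
  have h1 := congrArg Subtype.val (archPart_finAdelicToAdelic (↥(maximalRealSubfield L)) L (IsCMField.complexConj L) N H z)
  rw [coe_archPart, OneMemClass.coe_one] at h1
  change GLn.toMixed N L (Subtype.val (finAdelicToAdelic (↥(maximalRealSubfield L)) L (IsCMField.complexConj L) N H z)) = 1 at h1
  apply Subtype.ext
  rw [coe_archPart, OneMemClass.coe_one]
  change GLn.toMixed N L (Subtype.val (Φ _)) = 1
  rw [hΦ, map_mul, map_mul, map_inv, h1, mul_one, mul_inv_cancel]

/-- **`(Φ (1, z))_f = B_f z B_f⁻¹`** in `GL_N(𝔸_{L,f})` (★ `sndHom_toAdeleGL`: `(B_𝔸)_f = B_f`). [cite: BorelJacquet1979, §4.1] [cite: PlatonovRapinchuk1994, §5.1] -/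
theorem coe_finPart_similCongr_finAdelicToAdelic (z : finAdelic (↥(maximalRealSubfield L)) L (IsCMField.complexConj L) N H) :
    ((finPart (↥(maximalRealSubfield L)) L (IsCMField.complexConj L) N H₀ (Φ (finAdelicToAdelic (↥(maximalRealSubfield L)) L (IsCMField.complexConj L) N H z)) :
        finAdelic (↥(maximalRealSubfield L)) L (IsCMField.complexConj L) N H₀) : GL (Fin N) (FiniteAdeleRing (𝓞 L) L)) =
      toFinAdeleGL L N B * (z : GL (Fin N) (FiniteAdeleRing (𝓞 L) L)) * (toFinAdeleGL L N B)⁻¹ := by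
  have h1 := congrArg Subtype.val (finPart_finAdelicToAdelic (↥(maximalRealSubfield L)) L (IsCMField.complexConj L) N H z)
  rw [coe_finPart] at h1
  change GLn.sndHom N L (Subtype.val (finAdelicToAdelic (↥(maximalRealSubfield L)) L (IsCMField.complexConj L) N H z)) = _ at h1
  rw [coe_finPart]
  change GLn.sndHom N L (Subtype.val (Φ _)) = _
  rw [hΦ, map_mul, map_mul, map_inv, h1, sndHom_toAdeleGL]

/-- **`Φ (1, z) = (1, (Φ (1, z))_f)`**: the image of a finite-adelic point is finite-adelic (★ `archToAdelic_mul_finAdelicToAdelic` with §1's trivial archimedean part).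
[cite: BorelJacquet1979, §4.1] -/
theorem similCongr_finAdelicToAdelic_eq (z : finAdelic (↥(maximalRealSubfield L)) L (IsCMField.complexConj L) N H) :
    Φ (finAdelicToAdelic (↥(maximalRealSubfield L)) L (IsCMField.complexConj L) N H z) =
      finAdelicToAdelic (↥(maximalRealSubfield L)) L (IsCMField.complexConj L) N H₀
        (finPart (↥(maximalRealSubfield L)) L (IsCMField.complexConj L) N H₀ (Φ (finAdelicToAdelic (↥(maximalRealSubfield L)) L (IsCMField.complexConj L) N H z))) := by
  conv_lhs => rw [← archToAdelic_mul_finAdelicToAdelic (↥(maximalRealSubfield L)) L (IsCMField.complexConj L) N H₀ (Φ _)]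
  rw [archPart_similCongr_finAdelicToAdelic B Φ hΦ z, map_one, one_mul]

/-! ## §2 The value law of `Φ` on the place-`v` inclusions -/

/-- **`Φ ∘ ι_v = ι⁰_v ∘ Ad(B_v)`** for the place inclusions `ι_v = finAdelicToAdelic ∘ inclPlace v` (`y ↦ (1, …, 1, y, 1, …)`): for ANY identification
`e_v : U(H)(L⁺_v) ≃ₜ* U(H₀)(L⁺_v)` with the value law `e_v g = B_v g B_v⁻¹` (`B_v = toLocalGL L v B`; e.g. ★ `cmDatumLocalCongr L v (toLocalGL L v B) _ _`),
`Φ (ι_v y) = ι⁰_v (localPiEquiv_{H₀}⁻¹ (e_v (localPiEquiv_H y)))` — coordinates at `w ∣ v`: `B_w y_w B_w⁻¹` on both sides (★ `evalAt_inclPlace_of_over`, ★ `evalAt_toFinAdeleGL`,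
★ `localGLPiEquiv_toLocalGL_apply`); at `w ∤ v`: `B_w 1 B_w⁻¹ = 1`.  [cite: PlatonovRapinchuk1994, §5.1] [cite: Rogawski1990, §14.2 p. 232] -/
theorem similCongr_inclPlaceAdelic (v : HeightOneSpectrum (𝓞 ↥(maximalRealSubfield L)))
    (ev : (cmDatum L N H).Local v ≃ₜ* (cmDatum L N H₀).Local v)
    (hev : ∀ g : (cmDatum L N H).Local v, ((ev g).val : GL (Fin N) (LocalRing L v)) = toLocalGL L v B * (g.val : GL (Fin N) (LocalRing L v)) * (toLocalGL L v B)⁻¹)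
    (y : localPi L (IsCMField.complexConj L) N H v) :
    Φ (finAdelicToAdelic (↥(maximalRealSubfield L)) L (IsCMField.complexConj L) N H (inclPlace (↥(maximalRealSubfield L)) L (IsCMField.complexConj L) N H v y)) =
      finAdelicToAdelic (↥(maximalRealSubfield L)) L (IsCMField.complexConj L) N H₀
        (inclPlace (↥(maximalRealSubfield L)) L (IsCMField.complexConj L) N H₀ v
          ((localPiEquiv L (IsCMField.complexConj L) N H₀ v).symm (ev (localPiEquiv L (IsCMField.complexConj L) N H v y)))) := by
  rw [similCongr_finAdelicToAdelic_eq B Φ hΦ]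
  congr 1
  refine eq_of_forall_evalPlace_eq (↥(maximalRealSubfield L)) L (IsCMField.complexConj L) N H₀ fun v' => Subtype.ext (funext fun w => ?_)
  rw [coe_evalPlace_apply, coe_evalPlace_apply, coe_finPart_similCongr_finAdelicToAdelic B Φ hΦ, map_mul, map_mul, map_inv, evalAt_toFinAdeleGL]
  by_cases hv' : v' = v
  · subst hv'
    rw [evalAt_inclPlace_of_over, evalAt_inclPlace_of_over, coe_localPiEquiv_symm_apply, hev, map_mul, map_mul, map_inv, Pi.mul_apply, Pi.mul_apply,
      Pi.inv_apply, localGLPiEquiv_toLocalGL_apply, coe_localPiEquiv_apply, ContinuousMulEquiv.apply_symm_apply]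
  · rw [evalAt_inclPlace_of_not_over (↥(maximalRealSubfield L)) L (IsCMField.complexConj L) N H hv',
      evalAt_inclPlace_of_not_over (↥(maximalRealSubfield L)) L (IsCMField.complexConj L) N H₀ hv', mul_one, mul_inv_cancel]

end FinAdelic

/-! ## §3 Smooth vectors correspond under a `Φ`-equivariant isomorphism `e : P ≃ P₀` -/

section Smooth

variable {L : Type} [Field L] [NumberField L] [IsCMField L] {N : ℕ} {H₀ H : Matrix (Fin N) (Fin N) L} (B : GL (Fin N) L)
  (Φ : (adelicGroupData (↥(maximalRealSubfield L)) L (IsCMField.complexConj L) N H).Adelic ≃ₜ*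
    (adelicGroupData (↥(maximalRealSubfield L)) L (IsCMField.complexConj L) N H₀).Adelic)
  (hΦ : ∀ x : (adelicGroupData (↥(maximalRealSubfield L)) L (IsCMField.complexConj L) N H).Adelic,
    (Subtype.val (Φ x) : GL (Fin N) (AdeleRing (𝓞 L) L)) = toAdeleGL L B * (Subtype.val x : GL (Fin N) (AdeleRing (𝓞 L) L)) * (toAdeleGL L B)⁻¹)
  {μ : Measure (adelicGroupData (↥(maximalRealSubfield L)) L (IsCMField.complexConj L) N H).automorphicQuotient}
  {μ₀ : Measure (adelicGroupData (↥(maximalRealSubfield L)) L (IsCMField.complexConj L) N H₀).automorphicQuotient}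
  [SMulInvariantMeasure (adelicGroupData (↥(maximalRealSubfield L)) L (IsCMField.complexConj L) N H).Adelic
    (adelicGroupData (↥(maximalRealSubfield L)) L (IsCMField.complexConj L) N H).automorphicQuotient μ]
  [SMulInvariantMeasure (adelicGroupData (↥(maximalRealSubfield L)) L (IsCMField.complexConj L) N H₀).Adelic
    (adelicGroupData (↥(maximalRealSubfield L)) L (IsCMField.complexConj L) N H₀).automorphicQuotient μ₀]
  (P : DiscreteAutomorphicRep (adelicGroupData (↥(maximalRealSubfield L)) L (IsCMField.complexConj L) N H) μ)
  (P₀ : DiscreteAutomorphicRep (adelicGroupData (↥(maximalRealSubfield L)) L (IsCMField.complexConj L) N H₀) μ₀)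
  (e : P.space.toSubmodule ≃L[ℂ] P₀.space.toSubmodule)
  (he : ∀ (g : (adelicGroupData (↥(maximalRealSubfield L)) L (IsCMField.complexConj L) N H).Adelic) (w : P.space.toSubmodule),
    e (P.space.toContRep g w) = P₀.space.toContRep (Φ g) (e w))

include hΦ he

/-- **Stabilisers correspond**: `z₀ ∈ U(H₀)(𝔸_f)` fixes `e w` iff `(Φ⁻¹ (1, z₀))_f ∈ U(H)(𝔸_f)` fixes `w` (`e⁻¹ (P₀(g₀) w₀) = P(Φ⁻¹ g₀) (e⁻¹ w₀)`, ★ `equivariant_symm`, and §1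
for `Φ⁻¹`). [cite: BorelJacquet1979, §4.6] [cite: Rogawski1990, §14.2 p. 234] -/
theorem mem_stabilizer_finRep_iff_of_equivariant (w : P.space.toSubmodule) (z₀ : finAdelic (↥(maximalRealSubfield L)) L (IsCMField.complexConj L) N H₀) :
    z₀ ∈ P₀.finRep.stabilizerSubgroup (e w) ↔
      finPart (↥(maximalRealSubfield L)) L (IsCMField.complexConj L) N H
          (Φ.symm (finAdelicToAdelic (↥(maximalRealSubfield L)) L (IsCMField.complexConj L) N H₀ z₀)) ∈ P.finRep.stabilizerSubgroup w := by
  have he' := equivariant_symm e Φ.toMulEquiv he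
  rw [Representation.mem_stabilizerSubgroup, Representation.mem_stabilizerSubgroup]
  change P₀.space.toContRep (finAdelicToAdelic (↥(maximalRealSubfield L)) L (IsCMField.complexConj L) N H₀ z₀) (e w) = e w ↔
    P.space.toContRep (finAdelicToAdelic (↥(maximalRealSubfield L)) L (IsCMField.complexConj L) N H _) w = w
  rw [← similCongr_finAdelicToAdelic_eq B⁻¹ Φ.symm (similCongr_symm_val B Φ hΦ) z₀, ← e.symm.injective.eq_iff, he', e.symm_apply_apply]
  exact Iff.rfl

/-- **Smooth vectors correspond**: `w` is a smooth vector of `P|_{U(H)(𝔸_f)}` iff `e w` is a smooth vector of `P₀|_{U(H₀)(𝔸_f)}` — the stabilisers are preimages of each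
other under the CONTINUOUS maps `z₀ ↦ (Φ⁻¹ (1, z₀))_f`, `z ↦ (Φ (1, z))_f`. [cite: BorelJacquet1979, §4.6] [cite: Rogawski1990, §14.2 p. 234] -/
theorem isSmoothVector_finRep_iff_of_equivariant (w : P.space.toSubmodule) :
    P.finRep.IsSmoothVector w ↔ P₀.finRep.IsSmoothVector (e w) := by
  have hΦ' := similCongr_symm_val B Φ hΦ
  -- the stabiliser of `e w` is the preimage of the stabiliser of `w` under `z₀ ↦ (Φ⁻¹ (1, z₀))_f`
  have hset : (P₀.finRep.stabilizerSubgroup (e w) : Set (finAdelic (↥(maximalRealSubfield L)) L (IsCMField.complexConj L) N H₀)) =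
      (fun z₀ => finPart (↥(maximalRealSubfield L)) L (IsCMField.complexConj L) N H
        (Φ.symm (finAdelicToAdelic (↥(maximalRealSubfield L)) L (IsCMField.complexConj L) N H₀ z₀))) ⁻¹'
        (P.finRep.stabilizerSubgroup w : Set (finAdelic (↥(maximalRealSubfield L)) L (IsCMField.complexConj L) N H)) := by
    ext z₀
    rw [Set.mem_preimage, SetLike.mem_coe, SetLike.mem_coe]
    exact mem_stabilizer_finRep_iff_of_equivariant B Φ hΦ P P₀ e he w z₀
  -- and conversely (apply the same to `Φ⁻¹`, `e⁻¹`, `B⁻¹`)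
  have he' : ∀ (g₀ : (adelicGroupData (↥(maximalRealSubfield L)) L (IsCMField.complexConj L) N H₀).Adelic) (w₀ : P₀.space.toSubmodule),
      e.symm (P₀.space.toContRep g₀ w₀) = P.space.toContRep (Φ.symm g₀) (e.symm w₀) := equivariant_symm e Φ.toMulEquiv he
  have hset' : (P.finRep.stabilizerSubgroup w : Set (finAdelic (↥(maximalRealSubfield L)) L (IsCMField.complexConj L) N H)) =
      (fun z => finPart (↥(maximalRealSubfield L)) L (IsCMField.complexConj L) N H₀
        (Φ.symm.symm (finAdelicToAdelic (↥(maximalRealSubfield L)) L (IsCMField.complexConj L) N H z))) ⁻¹'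
        (P₀.finRep.stabilizerSubgroup (e w) : Set (finAdelic (↥(maximalRealSubfield L)) L (IsCMField.complexConj L) N H₀)) := by
    ext z
    rw [Set.mem_preimage, SetLike.mem_coe, SetLike.mem_coe]
    have h := mem_stabilizer_finRep_iff_of_equivariant B⁻¹ Φ.symm hΦ' P₀ P e.symm he' (e w) z
    rw [e.symm_apply_apply] at h
    exact h
  rw [Representation.IsSmoothVector, Representation.IsSmoothVector]
  constructor
  · intro h
    rw [hset]
    exact h.preimage ((continuous_finPart _ _ _ _ _).comp (Φ.symm.continuous.comp (continuous_finAdelicToAdelic _ _ _ _ _)))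
  · intro h
    rw [hset']
    exact h.preimage ((continuous_finPart _ _ _ _ _).comp (Φ.symm.symm.continuous.comp (continuous_finAdelicToAdelic _ _ _ _ _)))

/-! ## §4 The local equivalences `φ v` (the binder of ★ `R90.S9.comap_isConstituentOf_iff_of_localEquiv`) -/

set_option maxHeartbeats 400000 in
/-- **THE (B3a) → (B3b) JUNCTION.**  Along a `Φ`-equivariant `e : P ≃ P₀` (`Φ x = B_𝔸 x B_𝔸⁻¹`), at EVERY finite `v` and for ANY identification `e_v : U(H)(L⁺_v) ≃ₜ* U(H₀)(L⁺_v)` with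
`e_v g = B_v g B_v⁻¹`: an EQUIVALENCE (Mathlib `Representation.Equiv`) between the smooth local representation `P₀|^{∞} ∘ inclPlace_v` of `U(H₀)` on ★ `localPi … H₀ v` and the smooth
local representation of `P` pulled back along `ψ_v = localPiEquiv_{H₀} ≫ e_v⁻¹ ≫ localPiEquiv_H⁻¹` — LITERALLY the binder `φ v` of ★ `R90.S9.comap_isConstituentOf_iff_of_localEquiv`
(p861492) — given by `e⁻¹` on vectors.  So the local constituents of `P₀` and `P` correspond (both directions), «the equivalence classes of representations of `G_v` and
`G′_v` are canonically identified» [§14.2].  [cite: Rogawski1990, §14.2 pp. 232–234] [cite: PlatonovRapinchuk1994, §2.3, §5.1] [cite: BorelJacquet1979, §4.6] -/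
theorem exists_localEquiv_of_equivariant (v : HeightOneSpectrum (𝓞 ↥(maximalRealSubfield L)))
    (ev : (cmDatum L N H).Local v ≃ₜ* (cmDatum L N H₀).Local v)
    (hev : ∀ g : (cmDatum L N H).Local v, ((ev g).val : GL (Fin N) (LocalRing L v)) = toLocalGL L v B * (g.val : GL (Fin N) (LocalRing L v)) * (toLocalGL L v B)⁻¹) :
    ∃ φ : Representation.Equiv
        (P₀.finRep.smoothPart.toRepresentation.comp (inclPlace (↥(maximalRealSubfield L)) L (IsCMField.complexConj L) N H₀ v))
        ((P.finRep.smoothPart.toRepresentation.comp (inclPlace (↥(maximalRealSubfield L)) L (IsCMField.complexConj L) N H v)).comp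
          (((localPiEquiv L (IsCMField.complexConj L) N H₀ v).trans ((ev).symm.trans (localPiEquiv L (IsCMField.complexConj L) N H v).symm) :
              localPi L (IsCMField.complexConj L) N H₀ v ≃ₜ* localPi L (IsCMField.complexConj L) N H v) :
            localPi L (IsCMField.complexConj L) N H₀ v →* localPi L (IsCMField.complexConj L) N H v)),
      ∀ w₀ : P₀.finRep.smoothPart.toSubmodule, ((φ w₀ : P.finRep.smoothPart.toSubmodule) : P.space.toSubmodule) = e.symm (w₀ : P₀.space.toSubmodule) := by
  have hsm := isSmoothVector_finRep_iff_of_equivariant B Φ hΦ P P₀ e he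
  have he' : ∀ (g₀ : (adelicGroupData (↥(maximalRealSubfield L)) L (IsCMField.complexConj L) N H₀).Adelic) (w₀ : P₀.space.toSubmodule),
      e.symm (P₀.space.toContRep g₀ w₀) = P.space.toContRep (Φ.symm g₀) (e.symm w₀) := equivariant_symm e Φ.toMulEquiv he
  -- `e⁻¹` restricted to the smooth parts, as a linear equivalence
  let E : P₀.finRep.smoothPart.toSubmodule ≃ₗ[ℂ] P.finRep.smoothPart.toSubmodule :=
    { toFun := fun w₀ => ⟨e.symm (w₀ : P₀.space.toSubmodule), (hsm _).2 (by rw [e.apply_symm_apply]; exact w₀.2)⟩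
      map_add' := fun w₀ w₀' => Subtype.ext (map_add e.symm (w₀ : P₀.space.toSubmodule) (w₀' : P₀.space.toSubmodule))
      map_smul' := fun c w₀ => Subtype.ext (map_smul e.symm c (w₀ : P₀.space.toSubmodule))
      invFun := fun w => ⟨e (w : P.space.toSubmodule), (hsm _).1 w.2⟩
      left_inv := fun w₀ => Subtype.ext (e.apply_symm_apply (w₀ : P₀.space.toSubmodule))
      right_inv := fun w => Subtype.ext (e.symm_apply_apply (w : P.space.toSubmodule)) }
  refine ⟨Representation.Equiv.mk E fun x => LinearMap.ext fun w₀ => Subtype.ext ?_, fun w₀ => rfl⟩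
  -- the intertwining law `e⁻¹ (P₀(ι⁰_v x) w₀) = P(ι_v (ψ_v x)) (e⁻¹ w₀)` from §2 at `y := ψ_v x`
  have key := similCongr_inclPlaceAdelic B Φ hΦ v ev hev
    ((localPiEquiv L (IsCMField.complexConj L) N H v).symm (ev.symm (localPiEquiv L (IsCMField.complexConj L) N H₀ v x)))
  rw [ContinuousMulEquiv.apply_symm_apply, ContinuousMulEquiv.apply_symm_apply, ContinuousMulEquiv.symm_apply_apply] at key
  have key' := congrArg Φ.symm key
  rw [ContinuousMulEquiv.symm_apply_apply] at key'
  change e.symm (P₀.space.toContRep (finAdelicToAdelic (↥(maximalRealSubfield L)) L (IsCMField.complexConj L) N H₀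
      (inclPlace (↥(maximalRealSubfield L)) L (IsCMField.complexConj L) N H₀ v x)) (w₀ : P₀.space.toSubmodule)) =
    P.space.toContRep (finAdelicToAdelic (↥(maximalRealSubfield L)) L (IsCMField.complexConj L) N H
      (inclPlace (↥(maximalRealSubfield L)) L (IsCMField.complexConj L) N H v
        ((localPiEquiv L (IsCMField.complexConj L) N H v).symm (ev.symm (localPiEquiv L (IsCMField.complexConj L) N H₀ v x)))))
      (e.symm (w₀ : P₀.space.toSubmodule))
  rw [he', ← key']

end Smooth

/-! ## §5 Assembled from (B3)'s binders: `ᵗB̄ (a • H₀) B = H`, `a ≠ 0` -/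

section Assembled

variable (L : Type) [Field L] [NumberField L] [IsCMField L] (N : ℕ) (H₀ H : Matrix (Fin N) (Fin N) L)

/-- **(B3a)+junction, ONE CALL for the (B3) assembler.**  From (B3)'s own binders `formCongr (cmConjRingHom L) B (a • H₀) = H`, `a ≠ 0` (for (B3): `H₀ = qsForm L`), an automorphic
measure `μ` on `U(H)(L⁺)\U(H)(𝔸)` and a discrete automorphic `P` of `U(H)` (typed on `adelicGroupData L⁺ L c N H` as in (B0) `XiMembershipAt`): the similitude `Φ x = B_𝔸 x B_𝔸⁻¹`,
the homeomorphism `Ψ` of automorphic quotients (`Ψ [x] = [Φ x]`), the AUTOMORPHIC measure `Ψ_* μ` of `U(H₀)`, the discrete automorphic `P₀ = U(P)` of `U(H₀)` with the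
`Φ`-equivariant `e : P ≃ P₀` (★ `exists_similCongr_discreteAutomorphicRep`), AND at every finite `v`, for every identification `e_v` with `e_v g = B_v g B_v⁻¹`, the local
equivalence `φ v` of §4 (`= e⁻¹` on vectors) — the input of ★ `R90.S9.comap_isConstituentOf_iff_of_localEquiv` ∕ `memXiFamily_of_localCongr` (p861492).
[cite: Rogawski1990, §14.2 pp. 232–234; §1.9 p. 8] [cite: PlatonovRapinchuk1994, §2.3, §5.1] [cite: BorelJacquet1979, §4.1, §4.6] -/
theorem exists_similCongr_localEquiv (B : GL (Fin N) L) {a : L} (ha0 : a ≠ 0) (hB : formCongr (cmConjRingHom L) B (a • H₀) = H)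
    (μ : Measure (adelicGroupData (↥(maximalRealSubfield L)) L (IsCMField.complexConj L) N H).automorphicQuotient)
    [(adelicGroupData (↥(maximalRealSubfield L)) L (IsCMField.complexConj L) N H).IsAutomorphicMeasure μ]
    (P : DiscreteAutomorphicRep (adelicGroupData (↥(maximalRealSubfield L)) L (IsCMField.complexConj L) N H) μ) :
    ∃ (Φ : (adelicGroupData (↥(maximalRealSubfield L)) L (IsCMField.complexConj L) N H).Adelic ≃ₜ*
          (adelicGroupData (↥(maximalRealSubfield L)) L (IsCMField.complexConj L) N H₀).Adelic)
      (Ψ : (adelicGroupData (↥(maximalRealSubfield L)) L (IsCMField.complexConj L) N H).automorphicQuotient ≃ₜ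
          (adelicGroupData (↥(maximalRealSubfield L)) L (IsCMField.complexConj L) N H₀).automorphicQuotient)
      (_ : (adelicGroupData (↥(maximalRealSubfield L)) L (IsCMField.complexConj L) N H₀).IsAutomorphicMeasure (μ.map Ψ))
      (P₀ : DiscreteAutomorphicRep (adelicGroupData (↥(maximalRealSubfield L)) L (IsCMField.complexConj L) N H₀) (μ.map Ψ))
      (e : P.space.toSubmodule ≃L[ℂ] P₀.space.toSubmodule),
      (∀ x : (adelicGroupData (↥(maximalRealSubfield L)) L (IsCMField.complexConj L) N H).Adelic,
          (Subtype.val (Φ x) : GL (Fin N) (AdeleRing (𝓞 L) L)) = toAdeleGL L B * (Subtype.val x : GL (Fin N) (AdeleRing (𝓞 L) L)) * (toAdeleGL L B)⁻¹) ∧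
      (∀ x : (adelicGroupData (↥(maximalRealSubfield L)) L (IsCMField.complexConj L) N H).Adelic,
          Φ x ∈ (adelicGroupData (↥(maximalRealSubfield L)) L (IsCMField.complexConj L) N H₀).quotientSubgroup ↔
            x ∈ (adelicGroupData (↥(maximalRealSubfield L)) L (IsCMField.complexConj L) N H).quotientSubgroup) ∧
      (∀ x : (adelicGroupData (↥(maximalRealSubfield L)) L (IsCMField.complexConj L) N H).Adelic,
          Ψ ((adelicGroupData (↥(maximalRealSubfield L)) L (IsCMField.complexConj L) N H).toAutomorphicQuotient x) =
            (adelicGroupData (↥(maximalRealSubfield L)) L (IsCMField.complexConj L) N H₀).toAutomorphicQuotient (Φ x)) ∧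
      MeasurePreserving Ψ μ (μ.map Ψ) ∧
      (∀ (g : (adelicGroupData (↥(maximalRealSubfield L)) L (IsCMField.complexConj L) N H).Adelic) (w : P.space.toSubmodule),
          e (P.space.toContRep g w) = P₀.space.toContRep (Φ g) (e w)) ∧
      (∀ w : P.space.toSubmodule, ((e w : P₀.space.toSubmodule) : (adelicGroupData (↥(maximalRealSubfield L)) L (IsCMField.complexConj L) N H₀).L2 (μ.map Ψ)) =ᵐ[μ.map Ψ]
          fun y => ((w : P.space.toSubmodule) : (adelicGroupData (↥(maximalRealSubfield L)) L (IsCMField.complexConj L) N H).L2 μ) (Ψ.symm y)) ∧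
      ∀ (v : HeightOneSpectrum (𝓞 ↥(maximalRealSubfield L))) (ev : (cmDatum L N H).Local v ≃ₜ* (cmDatum L N H₀).Local v),
        (∀ g : (cmDatum L N H).Local v, ((ev g).val : GL (Fin N) (LocalRing L v)) = toLocalGL L v B * (g.val : GL (Fin N) (LocalRing L v)) * (toLocalGL L v B)⁻¹) →
        ∃ φ : Representation.Equiv
            (P₀.finRep.smoothPart.toRepresentation.comp (inclPlace (↥(maximalRealSubfield L)) L (IsCMField.complexConj L) N H₀ v))
            ((P.finRep.smoothPart.toRepresentation.comp (inclPlace (↥(maximalRealSubfield L)) L (IsCMField.complexConj L) N H v)).comp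
              (((localPiEquiv L (IsCMField.complexConj L) N H₀ v).trans ((ev).symm.trans (localPiEquiv L (IsCMField.complexConj L) N H v).symm) :
                  localPi L (IsCMField.complexConj L) N H₀ v ≃ₜ* localPi L (IsCMField.complexConj L) N H v) :
                localPi L (IsCMField.complexConj L) N H₀ v →* localPi L (IsCMField.complexConj L) N H v)),
          ∀ w₀ : P₀.finRep.smoothPart.toSubmodule, ((φ w₀ : P.finRep.smoothPart.toSubmodule) : P.space.toSubmodule) = e.symm (w₀ : P₀.space.toSubmodule) := by
  have hQ := formCongr_smul_to_simil (cmConjRingHom L) B ha0 H₀ H hB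
  -- the similitude of ★ `exists_adelicSimilCongr`, read on the `adelicGroupData` carriers (= the `cmDatum` carriers, ★ `adelicGroupData_eq_cmDatum`, `rfl`);
  -- (`Exists.elim` rather than `obtain`: `cases` against this large goal exhausts the heartbeat budget)
  refine (exists_adelicSimilCongr L N H₀ H a⁻¹ (inv_ne_zero ha0) B hQ).elim fun Φc hΦc => ?_
  have hlatc := similCongr_mem_quotientSubgroup_iff L N H₀ H a⁻¹ (inv_ne_zero ha0) B hQ Φc hΦc
  let Φ : (adelicGroupData (↥(maximalRealSubfield L)) L (IsCMField.complexConj L) N H).Adelic ≃ₜ*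
      (adelicGroupData (↥(maximalRealSubfield L)) L (IsCMField.complexConj L) N H₀).Adelic := Φc
  have hΦ : ∀ x : (adelicGroupData (↥(maximalRealSubfield L)) L (IsCMField.complexConj L) N H).Adelic,
      (Subtype.val (Φ x) : GL (Fin N) (AdeleRing (𝓞 L) L)) = toAdeleGL L B * (Subtype.val x : GL (Fin N) (AdeleRing (𝓞 L) L)) * (toAdeleGL L B)⁻¹ := hΦc
  have hlat : ∀ x : (adelicGroupData (↥(maximalRealSubfield L)) L (IsCMField.complexConj L) N H).Adelic,
      Φ x ∈ (adelicGroupData (↥(maximalRealSubfield L)) L (IsCMField.complexConj L) N H₀).quotientSubgroup ↔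
        x ∈ (adelicGroupData (↥(maximalRealSubfield L)) L (IsCMField.complexConj L) N H).quotientSubgroup := hlatc
  refine (exists_automorphicQuotient_congr Φ hlat).elim fun Ψ hΨ => ?_
  haveI hμ₀ := isAutomorphicMeasure_map_congrQuot Φ Ψ hΨ μ
  refine (exists_discreteAutomorphicRep_congr Φ Ψ hΨ μ (μ.map Ψ) (measurePreserving_congrQuot Ψ μ) P).elim fun U hU => hU.elim fun P₀ hP₀ => hP₀.elim fun e h => ?_
  refine ⟨Φ, Ψ, hμ₀, P₀, e, hΦ, hlat, hΨ, measurePreserving_congrQuot Ψ μ, h.2.2.2.2.2, fun w => ?_,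
    fun v ev hev => exists_localEquiv_of_equivariant B Φ hΦ P P₀ e h.2.2.2.2.2 v ev hev⟩
  rw [h.2.2.2.2.1 w]
  exact h.1 (w : (adelicGroupData (↥(maximalRealSubfield L)) L (IsCMField.complexConj L) N H).L2 μ)

/-- **The local form congruences of `B`**: `ᵗ(σB)·H₀·B = c • H` read over `L ⊗ L⁺_v` is `ᵗ((σ ⊗ 1) B_v)·(H₀)_v·B_v = c_v • H_v` (★ `formCongr_toLocalGL_one_smul`, entrywise `map_mul`) —
the hypothesis of ★ `cmDatumLocalCongr L v (toLocalGL L v B) _ _ : U(H)(L⁺_v) ≃ₜ* U(H₀)(L⁺_v)` (value law `g ↦ B_v g B_v⁻¹`, `rfl`), i.e. the local data `(T_v, a_v) := (B_v, c_v)` of ★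
`R90.S9.memXiFamily_of_localCongr` (p861492).  [cite: PlatonovRapinchuk1994, §2.3, §5.1] [cite: Rogawski1990, §14.2 p. 232] -/
theorem formCongr_toLocalGL_smul (B : GL (Fin N) L) {c : L}
    (hQ : (((B : GL (Fin N) L) : Matrix (Fin N) (Fin N) L).map (cmConjRingHom L))ᵀ * H₀ * ((B : GL (Fin N) L) : Matrix (Fin N) (Fin N) L) = c • H)
    (v : HeightOneSpectrum (𝓞 ↥(maximalRealSubfield L))) :
    formCongr (conjLocal L (IsCMField.complexConj L) v) (toLocalGL L v B) (H₀.map (algebraMap L (LocalRing L v))) =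
      algebraMap L (LocalRing L v) c • H.map (algebraMap L (LocalRing L v)) := by
  rw [formCongr_toLocalGL_one_smul L B hQ v, one_smul]
  ext i j
  simp only [Matrix.map_apply, Matrix.smul_apply, smul_eq_mul, map_mul]

end Assembled

end Summit.HodgeConjecture.HodgeConjecture.R90.S9

end
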